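import Literature.Topology.FourManifolds.DehnNielsenBaerFlowerMeridianTwist
import Mathlib.Analysis.InnerProductSpace.Calculus
import HarnessLib

/-!
# Dehn–Nielsen–Baer on the flower surface: the Dehn twists about the chain curves of `∂V_g`

Topic `Literature/Topology/FourManifolds`; seventh PROOF file of the named fact
`Literature.Topology.FourManifolds.DehnNielsenBaerSurfaceSmooth` (`DehnNielsenBaerSurface.lean`), companion of
`DehnNielsenBaerFlowerTwist.lean` (hole circles) and `DehnNielsenBaerFlowerMeridianTwist.lean`
(meridians).  Here: **the Dehn twists of the flower surface `∂V_g = {q_g(x, y) + z² = c_g}` about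
the chain curve `γ₀ = ∂V_g ∩ {x² + y² = rₐ²} ∩ (first valley)`** — the double of the arc of the
circle of radius `rₐ` (through the peaks) crossing the first valley of the flower domain from the
first hole to the second; it meets each of the two hole circles once —, as based diffeomorphisms of
`(∂V_g, x₀)` (the other chain curves are conjugates by the rotations).  They are the instance
`f = x² + y²` of `ThickenSurfaceTwist.exists_thickenSurfaceDehnTwist`
(first integrals `H = (x² + y², q_g ∘ π + z²)`):

* `FlowerModel.inner_self_perp`, `FlowerModel.im_toC_pol_pow` — `⟪p, ip⟫ = 0`,
  `Im (r e^{iθ})^g = r^g sin gθ`;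
* `FlowerModel.exists_delta_flowerD_perp_ne_zero` — **near the circle of radius `rₐ` and near the
  level `c_g` the angular derivative `dq_g(ip)` does not vanish** (compactness: on that circle and
  level, `sin gθ = 0` would give `q_g = q_g(rₐ) > c_g` or `q_g = rₐ² - V(rₐ) < c_g`);
* `FlowerModel.range_fderiv_pairH_normSq_eq_top` — hence `D(x² + y², q_g ∘ π + z²)` is onto on
  the preimage of a box around `(rₐ², c_g)`;
* `FlowerModel.exists_chainSection` — a smooth section
  `σ(a, c') = (√a e^{iπ/g}, √(c' - q_g(√a e^{iπ/g})))` of `H` over a box around `(rₐ², c_g)`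
  (on the first valley ray, where `q_g = r² - V(r)`), through the point of `γ₀` over the valley ray;
* `FlowerModel.exists_chainDehnTwist` — **the Dehn twists about `γ₀`** as diffeomorphisms of `∂V_g`
  fixing the base point `x₀ = (0, 0, √c_g)` (over the origin, off the family), with the explicit
  description of `ThickenSurfaceTwist`.

Everything is proved; no new definitions (D-0026).

## References

* B. Farb, D. Margalit, *A primer on mapping class groups*, PMS 49 (2012), §3.1.1, Thm. 4.1 and
  §4.4 (Lickorish–Humphries generators: the chain curves), Thm. 8.1. [FarbMargalit2012]
* H. Zieschang, E. Vogt, H.-D. Coldewey, *Surfaces and planar discontinuous groups*, LNM 835 (1980),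
  Thm. 5.6.1–5.6.2. [ZieschangVogtColdewey1980]
-/

open scoped Manifold ContDiff Topology Real InnerProductSpace
open Set Function Filter Metric Complex

noncomputable section

namespace Literature.Topology.FourManifolds

open PlanarThickening Literature.Geometry.Manifold Literature.AlgebraicTopology.FundamentalGroup
  PlanarLevelTwist

/-- Local notation: `𝔼 n` is the model Euclidean space `EuclideanSpace ℝ (Fin n)`. -/
local notation "𝔼 " n:arg => EuclideanSpace ℝ (Fin n)

namespace FlowerModel

variable {g : ℕ}

/-! ### §1 Two identities -/

/-- `p ⊥ ip`. [folklore] -/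
theorem inner_self_perp (p : 𝔼 2) : ⟪p, perp p⟫_ℝ = 0 := by
  have h : (starRingEnd ℂ) (toC p) * (I * toC p) = I * (toC p * (starRingEnd ℂ) (toC p)) := by ring
  rw [inner_eq_re, toC_perp, h, Complex.mul_conj, Complex.I_mul_re, Complex.ofReal_im, neg_zero]

/-- `Im (r e^{iθ})^g = r^g sin(gθ)`. [folklore] -/
theorem im_toC_pol_pow (r θ : ℝ) (n : ℕ) :
    ((toC (pol r θ)) ^ n).im = r ^ n * Real.sin (n * θ) := by
  rw [toC_pol, mul_pow, ← Complex.ofReal_pow, ← Complex.exp_nat_mul, Complex.im_ofReal_mul]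
  congr 1
  rw [show (n : ℂ) * (↑θ * I) = ((n * θ : ℝ) : ℂ) * I by push_cast; ring,
    Complex.exp_ofReal_mul_I_im]

/-! ### §2 The angular derivative does not vanish near the circle of radius `rₐ` and the level -/

/-- `q_g(rₐ e^{iθ}) = c_g` forces `sin gθ ≠ 0`: else the value would be the peak value
`q_g(rₐ) > c_g` or the valley value `rₐ² - V(rₐ) < c_g`. [folklore] -/
theorem sin_ne_zero_of_flower_pol_ra (hg : 2 ≤ g) {θ : ℝ} (h : flower g (pol (ra hg) θ) = level g) :
    Real.sin (g * θ) ≠ 0 := by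
  intro hs
  rw [flower_pol] at h
  rcases Real.sin_eq_zero_iff_cos_eq.1 hs with hc | hc
  · rw [hc, mul_one, ← prof_eq] at h
    linarith [level_lt_prof_ra hg]
  · rw [hc, mul_neg, mul_one] at h
    have hv : vprof g (ra hg) < level g := by
      rw [← vprof_rho4 hg]
      exact strictMonoOn_vprof hg (ra_pos hg).le (rho4_pos hg).le
        ((ra_lt_rt_seven hg).trans (rt_seven_lt_rho4 hg))
    exact absurd h (by rw [vprof] at hv; linarith)

/-- **Near the circle of radius `rₐ` and near the level `c_g` the angular derivative `dq_g(ip)` of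
the flower does not vanish**: there is `δ > 0` with `dq_g(p)(ip) ≠ 0` whenever
`|‖p‖² - rₐ²| < δ` and `|q_g(p) - c_g| < δ`. [folklore] -/
theorem exists_delta_flowerD_perp_ne_zero (hg : 2 ≤ g) :
    ∃ δ : ℝ, 0 < δ ∧ ∀ p : 𝔼 2, |‖p‖ ^ 2 - ra hg ^ 2| < δ → |flower g p - level g| < δ →
      fderiv ℝ (flower g) p (perp p) ≠ 0 := by
  have hg1 : 1 ≤ g := by omega
  have hperpc : Continuous (perp : 𝔼 2 → 𝔼 2) := by
    show Continuous fun p : 𝔼 2 => toC.symm (I * toC p)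
    exact toC.symm.continuous.comp (continuous_const.mul toC.continuous)
  have hdc : Continuous fun p : 𝔼 2 => fderiv ℝ (flower g) p (perp p) :=
    (contDiff_flower.continuous_fderiv (by simp)).clm_apply hperpc
  set C : Set (𝔼 2) := {p | |‖p‖ ^ 2 - ra hg ^ 2| ≤ 1} ∩
    (flower g ⁻¹' Icc (level g - 1) (level g + 1)) ∩ {p | fderiv ℝ (flower g) p (perp p) = 0}
    with hCdef
  have hnc : Continuous fun p : 𝔼 2 => |‖p‖ ^ 2 - ra hg ^ 2| :=
    continuous_abs.comp ((continuous_norm.pow 2).sub continuous_const)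
  have hCc : IsCompact C := by
    refine (isCompact_flower_preimage_Iic hg1
      (level g + 1)).of_isClosed_subset ?_ ?_
    · exact ((isClosed_le hnc continuous_const).inter
        (isClosed_Icc.preimage contDiff_flower.continuous)).inter (isClosed_eq hdc continuous_const)
    · rintro p ⟨⟨-, hp⟩, -⟩; exact hp.2
  set φ : 𝔼 2 → ℝ := fun p => max |‖p‖ ^ 2 - ra hg ^ 2| |flower g p - level g| with hφdef
  have hφc : Continuous φ := hnc.max (continuous_abs.comp (contDiff_flower.continuous.sub
    continuous_const))
  have hφpos : ∀ p ∈ C, 0 < φ p := by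
    rintro p ⟨⟨-, -⟩, hp⟩
    by_contra hle
    have h0 : φ p = 0 := le_antisymm (not_lt.1 hle) (le_max_of_le_left (abs_nonneg _))
    have hr : ‖p‖ = ra hg := by
      have : |‖p‖ ^ 2 - ra hg ^ 2| ≤ 0 := by rw [← h0]; exact le_max_left _ _
      have h1 : ‖p‖ ^ 2 = ra hg ^ 2 := by linarith [abs_nonpos_iff.1 this]
      exact (sq_eq_sq₀ (norm_nonneg p) (ra_pos hg).le).1 h1
    have hq : flower g p = level g := by
      have : |flower g p - level g| ≤ 0 := by rw [← h0]; exact le_max_right _ _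
      linarith [abs_nonpos_iff.1 this]
    obtain ⟨θ, -, hpθ⟩ := exists_eq_pol p
    rw [hr] at hpθ
    have hsin := sin_ne_zero_of_flower_pol_ra hg (θ := θ) (by rw [← hpθ]; exact hq)
    have hd : fderiv ℝ (flower g) p (perp p) = 0 := hp
    rw [fderiv_flower, flowerD_apply_perp hg1, hpθ, im_toC_pol_pow, neg_eq_zero] at hd
    rcases mul_eq_zero.1 hd with h1 | h1
    · exact (damp_pos (g := g) _).ne' h1
    · rcases mul_eq_zero.1 h1 with h2 | h2
      · exact pow_ne_zero _ (ra_pos hg).ne' h2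
      · exact hsin h2
  by_cases hCne : C.Nonempty
  · obtain ⟨p₀, hp₀, hmin⟩ := hCc.exists_isMinOn hCne hφc.continuousOn
    refine ⟨min (φ p₀) 1 / 2, div_pos (lt_min (hφpos p₀ hp₀) one_pos) two_pos,
      fun p hr hq hd => ?_⟩
    have hφp : φ p < min (φ p₀) 1 / 2 := max_lt hr hq
    have h1 := min_le_right (φ p₀) 1
    have hpC : p ∈ C := by
      refine ⟨⟨?_, ⟨?_, ?_⟩⟩, hd⟩
      · show |‖p‖ ^ 2 - ra hg ^ 2| ≤ 1; linarith
      · show level g - 1 ≤ flower g p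
        have h2 : |flower g p - level g| < 1 := by linarith
        linarith [(abs_lt.1 h2).1]
      · show flower g p ≤ level g + 1
        have h2 : |flower g p - level g| < 1 := by linarith
        linarith [(abs_lt.1 h2).2]
    have h5 : φ p₀ ≤ φ p := hmin hpC
    have h3 := min_le_left (φ p₀) 1
    have h4 := hφpos p₀ hp₀
    linarith
  · refine ⟨1 / 2, by norm_num, fun p hr hq hd => hCne ⟨p, ⟨⟨?_, ⟨?_, ?_⟩⟩, hd⟩⟩⟩
    · show |‖p‖ ^ 2 - ra hg ^ 2| ≤ 1; linarith
    · show level g - 1 ≤ flower g p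
      linarith [(abs_lt.1 hq).1]
    · show flower g p ≤ level g + 1
      linarith [(abs_lt.1 hq).2]

/-! ### §3 Regularity of `H = (x² + y², q_g ∘ π + z²)` near the chain level -/

/-- The squared planar radius `x² + y²` of a point of `ℝ³`. [folklore] -/
theorem hasFDerivAt_normSq_proj (x : 𝔼 3) :
    HasFDerivAt (fun x : 𝔼 3 => ‖proj x‖ ^ 2) ((2 • innerSL ℝ (proj x)).comp proj) x :=
  (hasStrictFDerivAt_norm_sq (proj x)).hasFDerivAt.comp x proj.hasFDerivAt

/-- `x² + y²` is smooth on `ℝ³`. [folklore] -/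
theorem contDiff_normSq_proj : ContDiff ℝ ∞ fun x : 𝔼 3 => ‖proj x‖ ^ 2 :=
  (contDiff_norm_sq ℝ).comp proj.contDiff

/-- The derivative of `x² + y²`. [folklore] -/
theorem fderiv_normSq_proj (x v : 𝔼 3) :
    fderiv ℝ (fun x : 𝔼 3 => ‖proj x‖ ^ 2) x v = 2 * ⟪proj x, proj v⟫_ℝ := by
  rw [(hasFDerivAt_normSq_proj x).fderiv]
  simp [innerSL_apply_apply]

/-- **`D(x² + y², q_g ∘ π + z²)` is onto** at every point with `|x² + y² - rₐ²| < δ` and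
`|q_g ∘ π + z² - c_g| < δ` for the `δ ≤ rₐ²` of `exists_delta_flowerD_perp_ne_zero` (test vectors:
the radial vector and `(0, 0, 1)` off the plane `z = 0`, the radial and the angular vector on it).
[folklore] -/
theorem range_fderiv_pairH_normSq_eq_top (hg : 2 ≤ g) {δ : ℝ} (hδ : δ ≤ ra hg ^ 2)
    (hreg : ∀ p : 𝔼 2, |‖p‖ ^ 2 - ra hg ^ 2| < δ → |flower g p - level g| < δ →
      fderiv ℝ (flower g) p (perp p) ≠ 0)
    {x : 𝔼 3} (hr : |‖proj x‖ ^ 2 - ra hg ^ 2| < δ) (ht : |thicken (flower g) x - level g| < δ) :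
    LinearMap.range (fderiv ℝ (pairH (fun x : 𝔼 3 => ‖proj x‖ ^ 2) (flower g)) x :
      𝔼 3 →ₗ[ℝ] ℝ × ℝ) = ⊤ := by
  have hdiff : Differentiable ℝ fun x : 𝔼 3 => ‖proj x‖ ^ 2 :=
    contDiff_normSq_proj.differentiable (by simp)
  have hp0 : proj x ≠ 0 := by
    intro h0
    rw [h0, norm_zero, zero_pow two_ne_zero, zero_sub, abs_neg,
      abs_of_pos (pow_pos (ra_pos hg) 2)] at hr
    linarith
  have hv : fderiv ℝ (fun x : 𝔼 3 => ‖proj x‖ ^ 2) x (lift (proj x)) ≠ 0 := by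
    rw [fderiv_normSq_proj, proj_lift, real_inner_self_eq_norm_sq]
    exact mul_ne_zero two_ne_zero (pow_ne_zero 2 (norm_ne_zero_iff.2 hp0))
  by_cases hz : x 2 = 0
  · refine range_fderiv_pairH_eq_top hdiff differentiable_flower hv (w := lift (perp (proj x)))
      ?_ ?_
    · rw [fderiv_normSq_proj, proj_lift, inner_self_perp, mul_zero]
    · rw [fderiv_thicken differentiable_flower]
      simp only [_root_.add_apply, ContinuousLinearMap.comp_apply, proj_lift,
        _root_.smul_apply, zc_apply, lift_apply_two, smul_eq_mul, mul_zero, add_zero]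
      refine hreg (proj x) hr ?_
      have : thicken (flower g) x = flower g (proj x) := by rw [thicken_apply, hz]; ring
      rwa [this] at ht
  · refine range_fderiv_pairH_eq_top hdiff differentiable_flower hv (w := ez) ?_ ?_
    · rw [fderiv_normSq_proj, proj_ez, inner_zero_right, mul_zero]
    · rw [fderiv_thicken differentiable_flower]
      simp only [_root_.add_apply, ContinuousLinearMap.comp_apply, proj_ez,
        map_zero, _root_.smul_apply, zc_apply, ez_apply_two, smul_eq_mul, mul_one,
        zero_add]
      exact mul_ne_zero two_ne_zero hz

/-! ### §4 The section through the chain curve, on the first valley ray -/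

/-- The ray `r ↦ r e^{iα}` is smooth in `r`. [folklore] -/
theorem contDiff_pol_left (α : ℝ) : ContDiff ℝ ∞ fun r : ℝ => pol r α := by
  have : (fun r : ℝ => pol r α) = fun r : ℝ => toC.symm ((↑r : ℂ) * Complex.exp ((α : ℂ) * I)) :=
    rfl
  rw [this]
  exact toC.symm.toContinuousLinearEquiv.contDiff.comp (Complex.ofRealCLM.contDiff.mul
    contDiff_const)

/-- **The section through the chain curve**: a smooth `σ : ℝ² → ℝ³` with
`σ(a, c') = (√a e^{iπ/g}, √(c' - q_g(√a e^{iπ/g})))` and `(x² + y², q_g ∘ π + z²)(σ(a, c')) = (a, c')`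
on a box around `(rₐ², c_g)`, and `σ(rₐ², c_g) = (rₐ e^{iπ/g}, √(c_g - (rₐ² - V rₐ)))`. [folklore] -/
theorem exists_chainSection (hg : 2 ≤ g) :
    ∃ (σ : ℝ × ℝ → 𝔼 3) (δ : ℝ), ContDiff ℝ ∞ σ ∧ 0 < δ ∧
      (∀ s ∈ Ioo (ra hg ^ 2 - δ) (ra hg ^ 2 + δ) ×ˢ Ioo (level g - δ) (level g + δ),
        pairH (fun x : 𝔼 3 => ‖proj x‖ ^ 2) (flower g) (σ s) = s) ∧
      (∀ s ∈ Ioo (ra hg ^ 2 - δ) (ra hg ^ 2 + δ) ×ˢ Ioo (level g - δ) (level g + δ),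
        proj (σ s) = pol (Real.sqrt s.1) (π / g)) ∧
      σ (ra hg ^ 2, level g) = lift (pol (ra hg) (π / g)) +
        Real.sqrt (level g - vprof g (ra hg)) • ez := by
  have hg1 : 1 ≤ g := by omega
  have hra := ra_pos hg
  -- clamps for the radius squared and for the radicand
  have hm₁ : 0 < ra hg ^ 2 := by positivity
  obtain ⟨κ₁, hκ₁s, hκ₁id, hκ₁low⟩ := exists_clampBelow hm₁
  have hv : vprof g (ra hg) < level g := by
    rw [← vprof_rho4 hg]
    exact strictMonoOn_vprof hg hra.le (rho4_pos hg).le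
      ((ra_lt_rt_seven hg).trans (rt_seven_lt_rho4 hg))
  set m₂ : ℝ := level g - vprof g (ra hg) with hm₂def
  have hm₂ : 0 < m₂ := by rw [hm₂def]; linarith
  obtain ⟨κ₂, hκ₂s, hκ₂id, hκ₂low⟩ := exists_clampBelow hm₂
  -- the planar point and its smoothness
  set Pt : ℝ → 𝔼 2 := fun a => pol (Real.sqrt (κ₁ a)) (π / g) with hPtdef
  have hsqrt : ContDiff ℝ ∞ fun a => Real.sqrt (κ₁ a) :=
    contDiff_iff_contDiffAt.2 fun a => hκ₁s.contDiffAt.sqrt (by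
      have := hκ₁low a; exact (lt_of_lt_of_le (by positivity) this).ne')
  have hPts : ContDiff ℝ ∞ Pt := (contDiff_pol_left _).comp hsqrt
  -- continuity of `a ↦ q(Pt a)` at `rₐ²`
  have hqc : Continuous fun a : ℝ => flower g (Pt a) := contDiff_flower.continuous.comp hPts.continuous
  have hPt0 : Pt (ra hg ^ 2) = pol (ra hg) (π / g) := by
    simp only [hPtdef]
    rw [hκ₁id _ (by linarith), Real.sqrt_sq hra.le]
  obtain ⟨δ₁, hδ₁, hδ₁q⟩ := Metric.continuous_iff.1 hqc (ra hg ^ 2) (m₂ / 4) (by positivity)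
  set δ : ℝ := min δ₁ (min (m₂ / 4) (ra hg ^ 2 / 2)) with hδdef
  have hδ : 0 < δ := lt_min hδ₁ (lt_min (by positivity) (by positivity))
  have hδ₁' : δ ≤ δ₁ := min_le_left _ _
  have hδm₂ : δ ≤ m₂ / 4 := (min_le_right _ _).trans (min_le_left _ _)
  have hδm₁ : δ ≤ ra hg ^ 2 / 2 := (min_le_right _ _).trans (min_le_right _ _)
  set σ : ℝ × ℝ → 𝔼 3 := fun s =>
    lift (Pt s.1) + Real.sqrt (κ₂ (s.2 - flower g (Pt s.1))) • ez with hσdef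
  have hrad : ContDiff ℝ ∞ fun s : ℝ × ℝ => κ₂ (s.2 - flower g (Pt s.1)) :=
    hκ₂s.comp (contDiff_snd.sub (contDiff_flower.comp (hPts.comp contDiff_fst)))
  have hsq : ContDiff ℝ ∞ fun s : ℝ × ℝ => Real.sqrt (κ₂ (s.2 - flower g (Pt s.1))) :=
    contDiff_iff_contDiffAt.2 fun s => (hrad.contDiffAt).sqrt
      (by have := hκ₂low (s.2 - flower g (Pt s.1)); exact (lt_of_lt_of_le (by positivity) this).ne')
  have hσs : ContDiff ℝ ∞ σ :=
    (lift.contDiff.comp (hPts.comp contDiff_fst)).add (hsq.smul (contDiff_const (c := ez)))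
  have hbox : ∀ s ∈ Ioo (ra hg ^ 2 - δ) (ra hg ^ 2 + δ) ×ˢ Ioo (level g - δ) (level g + δ),
      κ₁ s.1 = s.1 ∧ m₂ / 2 ≤ s.2 - flower g (Pt s.1) := by
    rintro s ⟨⟨ha1, ha2⟩, ⟨hc1, hc2⟩⟩
    have hκ : κ₁ s.1 = s.1 := hκ₁id _ (by linarith [hδm₁])
    refine ⟨hκ, ?_⟩
    have haδ₁ : dist s.1 (ra hg ^ 2) < δ₁ := by
      rw [Real.dist_eq, abs_lt]; constructor <;> linarith
    have hq := hδ₁q s.1 haδ₁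
    rw [Real.dist_eq, hPt0, flower_pol_valley hg1 (ra hg)] at hq
    have h1 := (abs_lt.1 hq).2
    have hF : flower g (Pt s.1) = vprof g (Real.sqrt (κ₁ s.1)) := flower_pol_valley hg1 _
    rw [hF] at h1 ⊢
    linarith
  refine ⟨σ, δ, hσs, hδ, fun s hs => ?_, fun s hs => ?_, ?_⟩
  · obtain ⟨hκ, hrad'⟩ := hbox s hs
    have hnn : 0 ≤ s.2 - flower g (Pt s.1) := by linarith
    have ha0 : 0 ≤ s.1 := by
      have := hs.1.1; linarith
    have hp : proj (σ s) = Pt s.1 := by simp [hσdef]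
    have h2 : σ s 2 = Real.sqrt (κ₂ (s.2 - flower g (Pt s.1))) := by simp [hσdef]
    refine Prod.ext ?_ ?_
    · show ‖proj (σ s)‖ ^ 2 = s.1
      rw [hp, hPtdef]
      dsimp only
      rw [norm_pol, sq_abs, hκ]
      exact Real.sq_sqrt ha0
    · show thicken (flower g) (σ s) = s.2
      rw [thicken_apply, hp, h2, hκ₂id _ hrad', Real.sq_sqrt hnn]
      ring
  · obtain ⟨hκ, -⟩ := hbox s hs
    have hp : proj (σ s) = Pt s.1 := by simp [hσdef]
    rw [hp, hPtdef]
    dsimp only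
    rw [hκ]
  · show lift (Pt (ra hg ^ 2)) + Real.sqrt (κ₂ (level g - flower g (Pt (ra hg ^ 2)))) • ez = _
    rw [hPt0, flower_pol_valley hg1, hκ₂id _ (by rw [hm₂def]; linarith)]

/-! ### §5 The Dehn twists about the chain curve `γ₀` -/

/-- **The Dehn twists of `∂V_g` about the chain curve `γ₀`** (the curve
`{x² + y² = rₐ²} ∩ ∂V_g` through `(rₐ e^{iπ/g}, √(c_g - q_g(rₐ e^{iπ/g})))`, in the first valley),
as diffeomorphisms of `∂V_g` fixing the base point `x₀`: a box half-width `0 < δ ≤ rₐ²/2`, the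
section `σ`, the cut-off `ψ` and the flow `θ` of `BoxLevelPackage.exists_boxLevelPackage` for
`H = (x² + y², q_g ∘ π + z²)`, one positive period of `γ₀`, and for every positive period `T₀`
and every `ε₀ > 0` the period function `P` on `S`, a width `0 < ε ≤ ε₀`, the twist profile `λ`
and a diffeomorphism `T` of `∂V_g` with `T x₀ = x₀`, equal to `x ↦ θ(λ(x² + y²), x)` at the
boundary points of the family with `x² + y² < rₐ² + 2ε` and to the identity at those off the
family or with `x² + y² ∉ [rₐ² - ε, rₐ²]`. [cite: FarbMargalit2012, §3.1.1 and Thm. 4.1] -/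
theorem exists_chainDehnTwist (hg : 2 ≤ g) :
    ∃ (δ : ℝ) (σ : ℝ × ℝ → 𝔼 3) (ψ : 𝔼 3 → ℝ) (θ : ℝ × 𝔼 3 → 𝔼 3), 0 < δ ∧ δ ≤ ra hg ^ 2 / 2 ∧
      ContDiff ℝ ∞ σ ∧
      (∀ s ∈ Ioo (ra hg ^ 2 - δ) (ra hg ^ 2 + δ) ×ˢ Ioo (level g - δ) (level g + δ),
        pairH (fun x : 𝔼 3 => ‖proj x‖ ^ 2) (flower g) (σ s) = s) ∧
      (∀ s ∈ Ioo (ra hg ^ 2 - δ) (ra hg ^ 2 + δ) ×ˢ Ioo (level g - δ) (level g + δ),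
        proj (σ s) = pol (Real.sqrt s.1) (π / g)) ∧
      σ (ra hg ^ 2, level g) = lift (pol (ra hg) (π / g)) +
        Real.sqrt (level g - vprof g (ra hg)) • ez ∧
      ContDiff ℝ ∞ ψ ∧
      (∀ x, pairH (fun x : 𝔼 3 => ‖proj x‖ ^ 2) (flower g) x ∈
          Ioo (ra hg ^ 2 - δ) (ra hg ^ 2 + δ) ×ˢ Ioo (level g - δ) (level g + δ) → ψ x = 1) ∧
      (∀ x, pairH (fun x : 𝔼 3 => ‖proj x‖ ^ 2) (flower g) x ∉
          Ioo (ra hg ^ 2 - 2 * δ) (ra hg ^ 2 + 2 * δ) ×ˢ Ioo (level g - 2 * δ) (level g + 2 * δ) →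
        ψ x = 0) ∧
      ContDiff ℝ ∞ θ ∧ (∀ x, θ (0, x) = x) ∧ (∀ t s x, θ (t, θ (s, x)) = θ (t + s, x)) ∧
      (∀ x t, HasDerivAt (fun t => θ (t, x))
        (twistField bE3 bF2 (pairH (fun x : 𝔼 3 => ‖proj x‖ ^ 2) (flower g)) ψ (θ (t, x))) t) ∧
      (∀ t x, pairH (fun x : 𝔼 3 => ‖proj x‖ ^ 2) (flower g) (θ (t, x)) =
        pairH (fun x : 𝔼 3 => ‖proj x‖ ^ 2) (flower g) x) ∧
      (∀ x, ψ x = 0 → ∀ t, θ (t, x) = x) ∧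
      (∃ T₀ : ℝ, 0 < T₀ ∧ θ (T₀, σ (ra hg ^ 2, level g)) = σ (ra hg ^ 2, level g)) ∧
      ∀ T₀ : ℝ, 0 < T₀ → θ (T₀, σ (ra hg ^ 2, level g)) = σ (ra hg ^ 2, level g) →
        ∀ ε₀ : ℝ, 0 < ε₀ →
        ∃ (P : ℝ × ℝ → ℝ) (S : Set (ℝ × ℝ)) (ε : ℝ) (lam : ℝ → ℝ)
          (T : (𝓡∂ 3).boundary (FlowerHandlebody hg) ≃ₘ⟮𝓡 2, 𝓡 2⟯
            (𝓡∂ 3).boundary (FlowerHandlebody hg)),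
          IsOpen S ∧ (ra hg ^ 2, level g) ∈ S ∧
          S ⊆ Ioo (ra hg ^ 2 - δ) (ra hg ^ 2 + δ) ×ˢ Ioo (level g - δ) (level g + δ) ∧
          ContDiffOn ℝ ∞ P S ∧ P (ra hg ^ 2, level g) = T₀ ∧ (∀ s ∈ S, 0 < P s) ∧
          (∀ s ∈ S, θ (P s, σ s) = σ s) ∧ IsOpen (flowSaturation θ σ S) ∧
          0 < ε ∧ ε ≤ ε₀ ∧
          (∀ a ∈ Icc (ra hg ^ 2 - 3 * ε) (ra hg ^ 2 + 3 * ε), (a, level g) ∈ S) ∧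
          ContDiff ℝ ∞ lam ∧ (∀ a, a ≤ ra hg ^ 2 - ε → lam a = 0) ∧
          (∀ a ∈ Icc (ra hg ^ 2) (ra hg ^ 2 + 2 * ε), lam a = P (a, level g)) ∧
          T (northPole hg) = northPole hg ∧
          (∀ z, boundaryIncl hg z ∈ flowSaturation θ σ S →
            ‖proj (boundaryIncl hg z)‖ ^ 2 < ra hg ^ 2 + 2 * ε →
            boundaryIncl hg (T z) =
              θ (lam (‖proj (boundaryIncl hg z)‖ ^ 2), boundaryIncl hg z)) ∧
          ∀ z, (boundaryIncl hg z ∉ flowSaturation θ σ S ∨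
            ‖proj (boundaryIncl hg z)‖ ^ 2 ∉ Icc (ra hg ^ 2 - ε) (ra hg ^ 2)) → T z = z := by
  have hg1 : 1 ≤ g := by omega
  have hra := ra_pos hg
  obtain ⟨δr, hδr, hreg0⟩ := exists_delta_flowerD_perp_ne_zero hg
  obtain ⟨σ, δs, hσs, hδs, hHσ0, hσproj0, hσ0⟩ := exists_chainSection hg
  set δ : ℝ := min (min δr δs) (ra hg ^ 2 / 2) with hδdef
  have hδ : 0 < δ := lt_min (lt_min hδr hδs) (by positivity)
  have hδr' : δ ≤ δr := (min_le_left _ _).trans (min_le_left _ _)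
  have hδs' : δ ≤ δs := (min_le_left _ _).trans (min_le_right _ _)
  have hδa : δ ≤ ra hg ^ 2 / 2 := min_le_right _ _
  set a₀ : ℝ := ra hg ^ 2 with ha₀def
  have hreg : ∀ x, pairH (fun x : 𝔼 3 => ‖proj x‖ ^ 2) (flower g) x ∈
      Ioo (a₀ - δ) (a₀ + δ) ×ˢ Ioo (level g - δ) (level g + δ) →
      LinearMap.range (fderiv ℝ (pairH (fun x : 𝔼 3 => ‖proj x‖ ^ 2) (flower g)) x :
        𝔼 3 →ₗ[ℝ] ℝ × ℝ) = ⊤ := by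
    rintro x ⟨⟨h1, h2⟩, ⟨h3, h4⟩⟩
    simp only [pairH_apply] at h1 h2 h3 h4
    refine range_fderiv_pairH_normSq_eq_top hg (δ := δ) (by linarith) (fun p hp hq =>
      hreg0 p (lt_of_lt_of_le hp hδr') (lt_of_lt_of_le hq hδr')) (abs_lt.2 ⟨by linarith, by linarith⟩)
      (abs_lt.2 ⟨by linarith, by linarith⟩)
  have hsub : Ioo (a₀ - δ) (a₀ + δ) ×ˢ Ioo (level g - δ) (level g + δ) ⊆
      Ioo (ra hg ^ 2 - δs) (ra hg ^ 2 + δs) ×ˢ Ioo (level g - δs) (level g + δs) := by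
    rintro s ⟨⟨h1, h2⟩, ⟨h3, h4⟩⟩
    exact ⟨⟨by linarith, by linarith⟩, ⟨by linarith, by linarith⟩⟩
  have hHσ : ∀ s ∈ Ioo (a₀ - δ) (a₀ + δ) ×ˢ Ioo (level g - δ) (level g + δ),
      pairH (fun x : 𝔼 3 => ‖proj x‖ ^ 2) (flower g) (σ s) = s := fun s hs => hHσ0 s (hsub hs)
  obtain ⟨ψ, θ, hψs, hψ1, hψzero, hθ, h0, hadd, hint, hHinv, hψfix, hper, htwist⟩ :=
    exists_thickenSurfaceDehnTwist contDiff_flower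
      (isCompact_flower_preimage_Iic hg1)
      contDiff_normSq_proj (isHoledDiscMorseFunction_flower hg).isRegularLevel hδ hreg hσs hHσ
      (a₀ := a₀) (a₁ := a₀) (a₂ := a₀) ⟨le_rfl, le_rfl⟩
  refine ⟨δ, σ, ψ, θ, hδ, hδa, hσs, hHσ, fun s hs => hσproj0 s (hsub hs), hσ0, hψs, hψ1, hψzero,
    hθ, h0, hadd, hint, hHinv, hψfix, hper, fun T₀ hT₀ hT ε₀ hε₀ => ?_⟩
  obtain ⟨P, S, ε, lam, T, hSo, hs₀S, hSJ, hPs, hP0, hPpos, hPS, hopen, hε, hεε₀, hparS, hlams,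
    hlam0, hlam1, hTon, hToff⟩ := htwist T₀ hT₀ hT ε₀ hε₀
  refine ⟨P, S, ε, lam, T, hSo, hs₀S, hSJ, hPs, hP0, hPpos, hPS, hopen, hε, hεε₀, hparS, hlams,
    hlam0, hlam1, ?_, hTon, hToff⟩
  -- the base point lies over the origin: its parameter `(0, c)` is outside the box, so off the family
  refine hToff _ (Or.inl fun hmem => ?_)
  change boundaryIncl hg (northPole hg) ∈ flowSaturation θ σ S at hmem
  rw [boundaryIncl_northPole] at hmem
  obtain ⟨u, s, hs, hus⟩ := mem_flowSaturation_iff.1 hmem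
  have hHtop : pairH (fun x : 𝔼 3 => ‖proj x‖ ^ 2) (flower g) (top g) = (0, level g) := by
    refine Prod.ext ?_ (thicken_top hg1)
    simp [top]
  have hs0 : s = (0, level g) := by
    rw [← hHσ s (hSJ hs), ← hHinv u (σ s), hus, hHtop]
  have h1 := (hSJ hs).1.1
  rw [hs0] at h1
  have : (0 : ℝ) ≤ a₀ - δ := by rw [ha₀def]; linarith
  exact absurd h1 (not_lt.2 this)

end FlowerModel

end Literature.Topology.FourManifolds

end
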